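import Summits.ValiantsHypothesis.ValiantsHypothesis.Theorems.LacunarySymmetroidMatrixDescartesPivotTwoDirections

/-!
# `MatrixDescartes` census — pivot column at `m = 2`: the one-against-parallel bound `2(K − 1)` is SHARP at `K = 3`
# (an integer two-direction pencil with EXACTLY four positive roots)

HONEST FRAMING.  Object-search cell `pub-symmetroid`, seat `val-sym-mdr-p1` (generation 12); helper file `--supports` the crux item
stmt-ValiantsHypothesis-18050 (`Theses.LacunarySymmetroid.MatrixDescartes`, OPEN, on HOLD) with NO closure claim.  Companion certificate of
`…PivotTwoDirections` (`posRoots_le_of_one_against_parallel`: in the hard cell, one letter against `K − 1` parallel letters ⇒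
`Z₊ ≤ 2(K − 1)`).  THE OBJECT (integer data; the `(2,1)` sub-block shape of the tree's arrowhead certificates, rescaled; this seat's
exp/sharp21.py): pivot `J = diag(3400, −3600)` at exponent `3` (`det J < 0`; index one with `W = (0, 60)ᵀ`), letters
`(6/5)·(1,1)(1,1)ᵀ` at exponent `0` and `60·(1,1)(1,1)ᵀ` at exponent `2` (direction `(1,1)`), `180000·(1,−1)(1,−1)ᵀ` at exponent `5`
(the lone letter in direction `(1,−1)`); both pairings equal `3400 − 3600 = −200 < 0` (hard cell).
`det F(t) = −240t³ + 852000t⁵ − 12240000t⁶ + 43200000t⁷ − 36000000t⁸` (Descartes-sharp: four sign variations) alternates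
`− + − + −` at `t = 1/100, 1/20, 1/5, 1/2, 1`, so `Z₊ ≥ 4`; with the companion's bound, **`sharp_pivotPosRoots_eq_four : Z₊ = 4`**
(`= 2(K − 1)` at `K = 3`, while the general `(2,3)` pivot row is `6`, tree `pivotRootLawAt_two_three`).  Nothing here bears on
`MatrixDescartes` in its window, on `DoorA26` / `DoorA34`, registers / credences, or `VP ≠ VNP`.

[folklore] Intermediate value theorem at rational points via the tree's kit (`Pivot.le_pivotPosRoots_of_certificate`); `norm_num`.
-/

-- `Summit.ValiantsHypothesis.ValiantsHypothesis.…` repeats a component by the D-0017 layout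
-- (single-conjunct summit), which the `dupNamespace` linter flags; the name is mandated.
set_option linter.dupNamespace false

namespace Summit.ValiantsHypothesis.ValiantsHypothesis.Theorems.LacunarySymmetroidMatrixDescartes.Pivot.TwoDirections

open Polynomial Matrix Finset
open scoped BigOperators


/-- Closed form of the determinant of the sharp `K = 3` object. -/
theorem sharp_eval_det (t : ℝ) :
    (t ^ 3 • (!![(3400 : ℝ), 0; 0, (-3600 : ℝ)] : Matrix (Fin 2) (Fin 2) ℝ)
      + ∑ k, t ^ (![0, 2, 5] : Fin 3 → ℕ) k •
        ((![!![(6 / 5 : ℝ), (6 / 5 : ℝ); (6 / 5 : ℝ), (6 / 5 : ℝ)],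
           !![(60 : ℝ), (60 : ℝ); (60 : ℝ), (60 : ℝ)],
           !![(180000 : ℝ), (-180000 : ℝ); (-180000 : ℝ), (180000 : ℝ)]]
          : Fin 3 → Matrix (Fin 2) (Fin 2) ℝ) k)).det
      = -240 * t ^ 3 + 852000 * t ^ 5 - 12240000 * t ^ 6 + 43200000 * t ^ 7 - 36000000 * t ^ 8 := by
  rw [Matrix.det_fin_two]
  simp [Matrix.add_apply, Fin.sum_univ_succ]
  ring

/-- The sharp object's pivot is symmetric. -/
theorem sharp_J_isSymm : ((!![(3400 : ℝ), 0; 0, (-3600 : ℝ)] : Matrix (Fin 2) (Fin 2) ℝ)).IsSymm := by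
  unfold Matrix.IsSymm; ext i j; fin_cases i <;> fin_cases j <;> rfl

/-- The sharp object's pivot has index one: `J + W Wᵀ = diag(3400, 0) ⪰ 0` for `W = (0, 60)ᵀ`. -/
theorem sharp_J_indexOne :
    ((!![(3400 : ℝ), 0; 0, (-3600 : ℝ)] : Matrix (Fin 2) (Fin 2) ℝ)
      + (!![(0 : ℝ); 60] : Matrix (Fin 2) (Fin 1) ℝ) * (!![(0 : ℝ); 60] : Matrix (Fin 2) (Fin 1) ℝ)ᵀ).PosSemidef := by
  have h : ((!![(3400 : ℝ), 0; 0, (-3600 : ℝ)] : Matrix (Fin 2) (Fin 2) ℝ)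
      + (!![(0 : ℝ); 60] : Matrix (Fin 2) (Fin 1) ℝ) * (!![(0 : ℝ); 60] : Matrix (Fin 2) (Fin 1) ℝ)ᵀ)
      = (3400 : ℝ) • vecMulVec ![(1 : ℝ), 0] ![(1 : ℝ), 0] := by
    ext i j
    fin_cases i <;> fin_cases j <;>
      (simp [Matrix.transpose_apply, Matrix.vecHead, Matrix.vecTail]; try norm_num)
  rw [h]
  exact posSemidef_smul_vecMulVec _ (by norm_num) _

/-- The sharp object's letters are the two-direction family `c k • w(side k) w(side k)ᵀ` with `w false = (1,−1)` (one
letter, `k = 2`), `w true = (1,1)` (two letters), weights `6/5, 60, 180000`. -/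
theorem sharp_letters_eq (k : Fin 3) :
    ((![!![(6 / 5 : ℝ), (6 / 5 : ℝ); (6 / 5 : ℝ), (6 / 5 : ℝ)],
           !![(60 : ℝ), (60 : ℝ); (60 : ℝ), (60 : ℝ)],
           !![(180000 : ℝ), (-180000 : ℝ); (-180000 : ℝ), (180000 : ℝ)]]
          : Fin 3 → Matrix (Fin 2) (Fin 2) ℝ) k)
      = (![(6 / 5 : ℝ), 60, 180000] : Fin 3 → ℝ) k
          • vecMulVec ((fun b : Bool => if b then (![(1 : ℝ), 1] : Fin 2 → ℝ) else ![(1 : ℝ), -1])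
              ((![true, true, false] : Fin 3 → Bool) k))
            ((fun b : Bool => if b then (![(1 : ℝ), 1] : Fin 2 → ℝ) else ![(1 : ℝ), -1])
              ((![true, true, false] : Fin 3 → Bool) k)) := by
  ext i j
  fin_cases k <;> fin_cases i <;> fin_cases j <;> simp

/-- The sharp object's letters are PSD. -/
theorem sharp_P_posSemidef (k : Fin 3) :
    ((![!![(6 / 5 : ℝ), (6 / 5 : ℝ); (6 / 5 : ℝ), (6 / 5 : ℝ)],
           !![(60 : ℝ), (60 : ℝ); (60 : ℝ), (60 : ℝ)],
           !![(180000 : ℝ), (-180000 : ℝ); (-180000 : ℝ), (180000 : ℝ)]]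
          : Fin 3 → Matrix (Fin 2) (Fin 2) ℝ) k).PosSemidef := by
  rw [sharp_letters_eq]
  refine posSemidef_smul_vecMulVec _ ?_ _
  fin_cases k <;> norm_num

/-- **`Z₊ ≥ 4`** for the sharp object: `det F` alternates `− + − + −` at `t = 1/100, 1/20, 1/5, 1/2, 1`. -/
theorem four_le_sharp_pivotPosRoots :
    4 ≤ pivotPosRoots 3 (![0, 2, 5] : Fin 3 → ℕ) ((!![(3400 : ℝ), 0; 0, (-3600 : ℝ)] : Matrix (Fin 2) (Fin 2) ℝ))
      ((![!![(6 / 5 : ℝ), (6 / 5 : ℝ); (6 / 5 : ℝ), (6 / 5 : ℝ)],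
           !![(60 : ℝ), (60 : ℝ); (60 : ℝ), (60 : ℝ)],
           !![(180000 : ℝ), (-180000 : ℝ); (-180000 : ℝ), (180000 : ℝ)]]
          : Fin 3 → Matrix (Fin 2) (Fin 2) ℝ)) :=
  le_pivotPosRoots_of_certificate (N := 4) sharp_eval_det
    ![1 / 100, 1 / 20, 1 / 5, 1 / 2, 1]
    (by
      refine Fin.strictMono_iff_lt_succ.2 fun j => ?_
      fin_cases j <;> simp only [Fin.castSucc_mk, Fin.succ_mk] <;> norm_num)
    (by intro j; fin_cases j <;> norm_num)
    (by intro j; fin_cases j <;> simp only [Fin.castSucc_mk, Fin.succ_mk] <;> norm_num)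

/-- **EXACTLY FOUR**: the sharp object attains the one-against-parallel bound `2(K − 1) = 4` at `K = 3` (while the `(2,3)`
pivot row is `6` for general letters, tree `pivotRootLawAt_two_three`): the bound of `pivotPosRoots_le_of_one_against_parallel`
is sharp at `K = 3` (and at `K = 2`, where the hard-cell rank-one count is `2`). -/
theorem sharp_pivotPosRoots_eq_four :
    pivotPosRoots 3 (![0, 2, 5] : Fin 3 → ℕ) ((!![(3400 : ℝ), 0; 0, (-3600 : ℝ)] : Matrix (Fin 2) (Fin 2) ℝ))
      ((![!![(6 / 5 : ℝ), (6 / 5 : ℝ); (6 / 5 : ℝ), (6 / 5 : ℝ)],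
           !![(60 : ℝ), (60 : ℝ); (60 : ℝ), (60 : ℝ)],
           !![(180000 : ℝ), (-180000 : ℝ); (-180000 : ℝ), (180000 : ℝ)]]
          : Fin 3 → Matrix (Fin 2) (Fin 2) ℝ)) = 4 := by
  refine le_antisymm ?_ four_le_sharp_pivotPosRoots
  have h := pivotPosRoots_le_of_one_against_parallel 3 (![0, 2, 5] : Fin 3 → ℕ)
    ((!![(3400 : ℝ), 0; 0, (-3600 : ℝ)] : Matrix (Fin 2) (Fin 2) ℝ))
    (fun b : Bool => if b then (![(1 : ℝ), 1] : Fin 2 → ℝ) else ![(1 : ℝ), -1])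
    (![true, true, false] : Fin 3 → Bool) (![(6 / 5 : ℝ), 60, 180000]) (by intro k; fin_cases k <;> norm_num)
    _ sharp_letters_eq (by simp [Matrix.det_fin_two]) (by simp; norm_num) (by simp; norm_num) (by decide)
  simpa using h

end Summit.ValiantsHypothesis.ValiantsHypothesis.Theorems.LacunarySymmetroidMatrixDescartes.Pivot.TwoDirections
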